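import Summits.ValiantsHypothesis.ValiantsHypothesis.Theorems.NcNonSkewDepthShapes
import HarnessLib

/-!
# The tilted sawtooth mask: blocks, pairing involution, balance and heights — H3b of O-L6-20 (T2)

The position set of the interval lemma ★`saw_designated` (`NcSawtoothDesignation`). Parameters:
`g ≥ 1` (gain), `t` (teeth); length `D = 6tg`; positions are read in BLOCKS of length `g`
(`i = g·q + r`, `q = i / g`, `r = i % g`) and all tooth arithmetic is on the block index `q` with
the literal `5`. The mask is `χ = (+^{2g} −^{3g})^t +^{tg}`: `t` teeth (ascent `2g`, descent `3g`),
then a final climb of `tg`; as a block bit, `bitB t q = [5t ≤ q ∨ q mod 5 < 2]` and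
`sawMask t g i = bitB t (i / g)`. BALANCE `|A| = |Aᶜ| = 3tg` (`card_sawMask`) comes from the explicit
fixed-point-free involution `sawMate` exchanging `A` and `Aᶜ` (block pairs: ascent block `5T+u`
↔ descent block `5T+u+2` for `u < 2`, last descent block `5T+4` ↔ block `T` of the final climb;
`mateB_spec`, `sawMate_sawMate`, `sawMask_sawMate`) — the same involution is the pairing of the
permanent transfer in `NcPairingPermanent`. HEIGHTS: block height `HB` (closed form), position height
`sawH t g i = g·HB(i/g) ± (i mod g)`; `sawH_succ` (one step = the bit), the LINK
`hgt_sawMask : hgt (sawMask t g) i = sawH t g i` with the generic height of `NcNonSkewDepthShapes`,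
and the closed forms on a tooth (`sawH_tooth`: with `x = g(5T+u)+r`, `h(x) + gT = r | g+r | 2g−r |
g−r | −r` for `u = 0 | 1 | 2 | 3 | 4`) and on the final climb (`sawH_final`: `h(5tg + s) = s − tg`).
MASK PROVENANCE: the tilted sawtooth mask and its pairing are this lane's OWN construction for the
non-skew-depth rung; FLOS20's journal-version masks (acq-15047, open want, not blocking) were not
consulted. MODEL (verbatim for every file): «Circuits ArithCircuit K σ read in FreeAlgebra K σ (ncEval), K a
field, σ finite; weighted sum gates of any fan-in, product gates of fan-in 1 or 2 (general fan-in: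
the landed binz of O-L6-19); the INPUT circuit of a rung is const-free with non-constant output
(print: homogenisation, HWY10 §2 / LMS16 Lemma 4.2 — not formalised; same clause as
ncPerPoly_uptPrint); the instrument (H2) is proved in the wider ZERO-CONST model (const operands
allowed iff 0) so that block substitutions with vanishing entries stay inside it.»
print-KNOWN (tilted masks: FLOS20 §5, Theorem 20) · kernel-NEW · INSTRUMENT · 0 S-currency ·
closes NO item · A_nc stmt-23446 / PerNotNcVP / VP ≠ VNP untouched.
[cite: FijalkowLagardeOhlmannSerre2020, §3.2 (heights, distance to a set), Theorem 13, Theorem 20, §5]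
[cite: LimayeMalodSrinivasan2016, Theorem 1.3, §6 (non-skew depth lower bound)]
-/

noncomputable section

namespace Summit.ValiantsHypothesis.ValiantsHypothesis.Theorems.NcSawtoothMask

set_option linter.dupNamespace false
open Summit.ValiantsHypothesis.ValiantsHypothesis.Theorems.NcNonSkewDepthShapes

/-! ### §1 Block bit and block pairing -/

/-- The bit of block `q`: `+` on the ascents (`q mod 5 < 2`) and on the final climb (`5t ≤ q`).
[cite: FijalkowLagardeOhlmannSerre2020, §5] -/
def bitB (t q : ℕ) : Bool := decide (5 * t ≤ q ∨ q % 5 < 2)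

/-- The mate of block `q`: ascent block `5T+u` ↔ descent block `5T+u+2` (`u < 2`); last descent block
`5T+4` ↔ block `T` of the final climb. [cite: FijalkowLagardeOhlmannSerre2020, §5] -/
def mateB (t q : ℕ) : ℕ :=
  if 5 * t ≤ q then 5 * (q - 5 * t) + 4
  else if q % 5 < 2 then q + 2 else if q % 5 < 4 then q - 2 else 5 * t + q / 5

/-- `mateB` is a fixed-point-free involution of `[0, 6t)` flipping the bit.
[cite: FijalkowLagardeOhlmannSerre2020, §5] -/
theorem mateB_spec {t q : ℕ} (hq : q < 6 * t) :
    mateB t q < 6 * t ∧ mateB t (mateB t q) = q ∧ (bitB t (mateB t q) = true ↔ bitB t q = false) := by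
  simp only [bitB, decide_eq_true_eq, decide_eq_false_iff_not]
  by_cases h1 : 5 * t ≤ q
  · have e : mateB t q = 5 * (q - 5 * t) + 4 := by simp [mateB, h1]
    have e' : mateB t (5 * (q - 5 * t) + 4) = 5 * t + (5 * (q - 5 * t) + 4) / 5 := by
      rw [mateB, if_neg (show ¬5 * t ≤ 5 * (q - 5 * t) + 4 by omega),
        if_neg (show ¬(5 * (q - 5 * t) + 4) % 5 < 2 by omega),
        if_neg (show ¬(5 * (q - 5 * t) + 4) % 5 < 4 by omega)]
    rw [e, e']
    refine ⟨by omega, by omega, fun _ => by omega, fun h => absurd (Or.inl h1) h⟩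
  · by_cases h2 : q % 5 < 2
    · have e : mateB t q = q + 2 := by simp [mateB, h1, h2]
      have e' : mateB t (q + 2) = q + 2 - 2 := by
        rw [mateB, if_neg (show ¬5 * t ≤ q + 2 by omega), if_neg (show ¬(q + 2) % 5 < 2 by omega),
          if_pos (show (q + 2) % 5 < 4 by omega)]
      rw [e, e']
      refine ⟨by omega, by omega, fun _ => by omega, fun h => absurd (Or.inr h2) h⟩
    · by_cases h3 : q % 5 < 4
      · have e : mateB t q = q - 2 := by simp [mateB, h1, h2, h3]
        have e' : mateB t (q - 2) = q - 2 + 2 := by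
          rw [mateB, if_neg (show ¬5 * t ≤ q - 2 by omega), if_pos (show (q - 2) % 5 < 2 by omega)]
        rw [e, e']
        exact ⟨by omega, by omega, fun _ => by omega, fun _ => by omega⟩
      · have e : mateB t q = 5 * t + q / 5 := by simp [mateB, h1, h2, h3]
        have e' : mateB t (5 * t + q / 5) = 5 * (5 * t + q / 5 - 5 * t) + 4 := by
          rw [mateB, if_pos (show 5 * t ≤ 5 * t + q / 5 by omega)]
        rw [e, e']
        exact ⟨by omega, by omega, fun _ => by omega, fun _ => by omega⟩

/-! ### §2 Block heights -/

/-- Height at the START of block `q` divided by `g` (closed form: tooth `T = q / 5`, phase `q mod 5`;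
final climb `q − 6t`). [cite: FijalkowLagardeOhlmannSerre2020, §3.2] -/
def HB (t q : ℕ) : ℤ :=
  if 5 * t ≤ q then (q : ℤ) - 6 * t
  else if q % 5 ≤ 2 then ((q % 5 : ℕ) : ℤ) - (q / 5 : ℕ) else ((4 - q % 5 : ℕ) : ℤ) - (q / 5 : ℕ)

/-- `HB t 0 = 0`. [cite: FijalkowLagardeOhlmannSerre2020, §3.2] -/
theorem HB_zero (t : ℕ) : HB t 0 = 0 := by
  unfold HB
  split_ifs <;> omega

/-- One block further: the block height moves by the bit of the block.
[cite: FijalkowLagardeOhlmannSerre2020, §3.2] -/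
theorem HB_succ (t q : ℕ) : HB t (q + 1) = HB t q + (if bitB t q = true then 1 else -1) := by
  simp only [HB, bitB, decide_eq_true_eq]
  split_ifs <;> omega

/-- Closed form on tooth `T < t`, phase `u < 5`: `HB = (u | u | u | 4−u | 4−u) − T`.
[cite: FijalkowLagardeOhlmannSerre2020, §3.2] -/
theorem HB_tooth {t T u : ℕ} (hT : T < t) (hu : u < 5) :
    HB t (5 * T + u) = (if u ≤ 2 then (u : ℤ) else ((4 - u : ℕ) : ℤ)) - T := by
  have e1 : (5 * T + u) % 5 = u := by omega
  have e2 : (5 * T + u) / 5 = T := by omega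
  unfold HB
  rw [if_neg (show ¬5 * t ≤ 5 * T + u by omega), e1, e2]
  split_ifs <;> omega

/-- Closed form on the final climb: `HB t (5t + s) = s − t`. [cite: FijalkowLagardeOhlmannSerre2020, §3.2] -/
theorem HB_final (t s : ℕ) : HB t (5 * t + s) = (s : ℤ) - t := by
  unfold HB
  rw [if_pos (show 5 * t ≤ 5 * t + s by omega)]
  omega

/-! ### §3 The mask, the pairing involution, balance -/

/-- Block coordinates: `(g·q + r) / g = q` and `(g·q + r) mod g = r` for `r < g`.
[cite: FijalkowLagardeOhlmannSerre2020, §5] -/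
theorem divmod {g : ℕ} (hg : 0 < g) (q : ℕ) {r : ℕ} (hr : r < g) :
    (g * q + r) / g = q ∧ (g * q + r) % g = r := by
  constructor
  · rw [Nat.add_comm, Nat.add_mul_div_left r q hg, Nat.div_eq_of_lt hr, Nat.zero_add]
  · rw [Nat.add_comm, Nat.add_mul_mod_self_left, Nat.mod_eq_of_lt hr]

/-- The tilted SAWTOOTH MASK `χ = (+^{2g} −^{3g})^t +^{tg}` on `Fin (6tg)` (`true = +`).
[cite: FijalkowLagardeOhlmannSerre2020, §5, Theorem 20] -/
def sawMask (t g : ℕ) : Fin (g * (6 * t)) → Bool := fun i => bitB t (i.val / g)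

/-- The PAIRING of positions: same offset inside the mated block.
[cite: FijalkowLagardeOhlmannSerre2020, §5] -/
def sawMate (t g : ℕ) (i : Fin (g * (6 * t))) : Fin (g * (6 * t)) :=
  ⟨g * mateB t (i.val / g) + i.val % g, by
    have hg : 0 < g := Nat.pos_of_ne_zero (by rintro rfl; exact absurd i.isLt (by simp))
    have h1 := (mateB_spec (Nat.div_lt_of_lt_mul i.isLt)).1
    have h2 := Nat.mod_lt i.val hg
    calc g * mateB t (i.val / g) + i.val % g < g * mateB t (i.val / g) + g := by omega
      _ = g * (mateB t (i.val / g) + 1) := by ring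
      _ ≤ g * (6 * t) := Nat.mul_le_mul_left g h1⟩

/-- `sawMate` is an involution. [cite: FijalkowLagardeOhlmannSerre2020, §5] -/
theorem sawMate_sawMate (t g : ℕ) (i : Fin (g * (6 * t))) : sawMate t g (sawMate t g i) = i := by
  have hg : 0 < g := Nat.pos_of_ne_zero (by rintro rfl; exact absurd i.isLt (by simp))
  obtain ⟨-, h2, -⟩ := mateB_spec (Nat.div_lt_of_lt_mul i.isLt)
  have hd := divmod hg (mateB t (i.val / g)) (Nat.mod_lt i.val hg)
  apply Fin.ext
  simp only [sawMate, hd.1, hd.2, h2]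
  exact Nat.div_add_mod i.val g

/-- `sawMate` exchanges the mask classes `A = {+}` and `Aᶜ`. [cite: FijalkowLagardeOhlmannSerre2020, §5] -/
theorem sawMask_sawMate (t g : ℕ) (i : Fin (g * (6 * t))) :
    sawMask t g (sawMate t g i) = !sawMask t g i := by
  have hg : 0 < g := Nat.pos_of_ne_zero (by rintro rfl; exact absurd i.isLt (by simp))
  obtain ⟨-, -, h3⟩ := mateB_spec (Nat.div_lt_of_lt_mul i.isLt)
  have hd := divmod hg (mateB t (i.val / g)) (Nat.mod_lt i.val hg)
  simp only [sawMask, sawMate, hd.1]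
  rcases Bool.eq_false_or_eq_true (bitB t (i.val / g)) with h | h
  · rw [h, Bool.not_true, Bool.eq_false_iff]
    intro h'
    rw [h3.mp h'] at h
    exact Bool.false_ne_true h
  · rw [h, Bool.not_false]
    exact h3.mpr h

/-- BALANCE: `|A| = |Aᶜ| = 3tg = D/2`. [cite: FijalkowLagardeOhlmannSerre2020, Theorem 13, §5] -/
theorem card_sawMask (t g : ℕ) :
    Fintype.card {i : Fin (g * (6 * t)) // sawMask t g i = true} = g * (3 * t) ∧
      Fintype.card {i : Fin (g * (6 * t)) // sawMask t g i = false} = g * (3 * t) := by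
  have e : Fintype.card {i : Fin (g * (6 * t)) // sawMask t g i = true} =
      Fintype.card {i : Fin (g * (6 * t)) // sawMask t g i = false} := by
    refine Fintype.card_congr
      ⟨fun i => ⟨sawMate t g i.1, by rw [sawMask_sawMate, i.2, Bool.not_true]⟩,
        fun i => ⟨sawMate t g i.1, by rw [sawMask_sawMate, i.2, Bool.not_false]⟩,
        fun i => Subtype.ext (sawMate_sawMate t g i.1),
        fun i => Subtype.ext (sawMate_sawMate t g i.1)⟩
  have s : Fintype.card {i : Fin (g * (6 * t)) // sawMask t g i = false} =
      Fintype.card {i : Fin (g * (6 * t)) // ¬sawMask t g i = true} :=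
    Fintype.card_congr (Equiv.subtypeEquivRight fun i => by rw [Bool.not_eq_true])
  rw [Fintype.card_subtype_compl, Fintype.card_fin] at s
  have hD : g * (6 * t) = 2 * (g * (3 * t)) := by ring
  omega

/-! ### §4 Position heights and the link with `hgt` -/

/-- Position height (closed form): `h(g·q + r) = g·HB(q) ± r`. [cite: FijalkowLagardeOhlmannSerre2020, §3.2] -/
def sawH (t g i : ℕ) : ℤ :=
  (g : ℤ) * HB t (i / g) + ((i % g : ℕ) : ℤ) * (if bitB t (i / g) = true then 1 else -1)

/-- `sawH` in block coordinates. [cite: FijalkowLagardeOhlmannSerre2020, §3.2] -/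
theorem sawH_blocks {t g : ℕ} (hg : 0 < g) (q : ℕ) {r : ℕ} (hr : r < g) :
    sawH t g (g * q + r) = g * HB t q + (if bitB t q = true then (r : ℤ) else -r) := by
  have hd := divmod hg q hr
  simp only [sawH, hd.1, hd.2]
  split_ifs <;> ring

/-- One position further: the height moves by the bit of the position's block.
[cite: FijalkowLagardeOhlmannSerre2020, §3.2] -/
theorem sawH_succ {t g : ℕ} (hg : 0 < g) (i : ℕ) :
    sawH t g (i + 1) = sawH t g i + (if bitB t (i / g) = true then 1 else -1) := by
  obtain ⟨q, r, hr, rfl⟩ : ∃ q r, r < g ∧ i = g * q + r :=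
    ⟨i / g, i % g, Nat.mod_lt i hg, (Nat.div_add_mod i g).symm⟩
  rw [(divmod hg q hr).1]
  by_cases h : r + 1 < g
  · rw [show g * q + r + 1 = g * q + (r + 1) by omega, sawH_blocks hg q h, sawH_blocks hg q hr]
    split_ifs <;> push_cast <;> ring
  · have e : g * q + r + 1 = g * (q + 1) + 0 := by rw [Nat.mul_add, Nat.mul_one]; omega
    have hr' : (r : ℤ) = g - 1 := by omega
    rw [e, sawH_blocks hg (q + 1) hg, HB_succ, sawH_blocks hg q hr]
    simp only [Nat.cast_zero, neg_zero, ite_self, add_zero]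
    split_ifs <;> rw [hr'] <;> ring

/-- THE LINK: the generic height of the sawtooth mask is `sawH`. [cite: FijalkowLagardeOhlmannSerre2020, §3.2] -/
theorem hgt_sawMask {t g : ℕ} (hg : 0 < g) {i : ℕ} (hi : i ≤ g * (6 * t)) :
    hgt (sawMask t g) i = sawH t g i := by
  induction i with
  | zero => simp [hgt_zero, sawH, HB_zero]
  | succ i ih =>
    rw [hgt_succ (sawMask t g) (show i < g * (6 * t) by omega), ih (by omega), sawH_succ hg]
    rfl

/-- Closed form on a tooth: for `x = g(5T+u) + r` (`T < t`, `u < 5`, `r < g`),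
`h(x) + gT = r | g + r | 2g − r | g − r | −r` according to `u = 0 | 1 | 2 | 3 | 4`.
[cite: FijalkowLagardeOhlmannSerre2020, §3.2, §5] -/
theorem sawH_tooth {t g T u r : ℕ} (hg : 0 < g) (hT : T < t) (hu : u < 5) (hr : r < g) :
    sawH t g (g * (5 * T + u) + r) + g * T =
      if u = 0 then (r : ℤ) else if u = 1 then (g : ℤ) + r else if u = 2 then 2 * (g : ℤ) - r
      else if u = 3 then (g : ℤ) - r else -(r : ℤ) := by
  rw [sawH_blocks hg _ hr, HB_tooth hT hu]
  have hb : (bitB t (5 * T + u) = true) = (u < 2) := by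
    simp only [bitB, decide_eq_true_eq, eq_iff_iff]
    exact ⟨fun h => by omega, fun h => Or.inr (by omega)⟩
  simp only [hb]
  rcases (show u = 0 ∨ u = 1 ∨ u = 2 ∨ u = 3 ∨ u = 4 by omega) with rfl | rfl | rfl | rfl | rfl <;>
    norm_num <;> ring

/-- Closed form on the final climb: `h(5tg + s) = s − tg`. [cite: FijalkowLagardeOhlmannSerre2020, §3.2, §5] -/
theorem sawH_final {t g : ℕ} (hg : 0 < g) (s : ℕ) : sawH t g (g * (5 * t) + s) = (s : ℤ) - g * t := by
  obtain ⟨a, b, hb, rfl⟩ : ∃ a b, b < g ∧ s = g * a + b :=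
    ⟨s / g, s % g, Nat.mod_lt s hg, (Nat.div_add_mod s g).symm⟩
  have hbit : bitB t (5 * t + a) = true := by
    unfold bitB
    exact decide_eq_true (Or.inl (Nat.le_add_right _ _))
  rw [show g * (5 * t) + (g * a + b) = g * (5 * t + a) + b by ring, sawH_blocks hg _ hb, HB_final,
    hbit, if_pos rfl]
  push_cast
  ring

end Summit.ValiantsHypothesis.ValiantsHypothesis.Theorems.NcSawtoothMask
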